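import Summits.AtomisticToContinuum.HydrodynamicLimit.Theorems.LambertianContactSwapLambertianWellPosedWindow
import Literature.Analysis.FluidPDE.HardSphereScattering

/-!
# The Lambertian hard-sphere flow over a short window: the annealed one-window transport

Helper file (`--supports`) of crux `LambertianEuler` (`AtomisticToContinuum/HydrodynamicLimit`,
stmt-AtomisticToContinuum-11854), line `Sketch`, stub `stub_windowLambda`: the WINDOW step of the
Liouville ⊗ noise invariance of the Lambertian flow `Λ`, transcribing the deterministic GST/Alexander
short-time analysis (`Literature.Analysis.FluidPDE.HardSphereShortTime` / `HardSphereScattering`) on the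
short-time good set `shortGood N ε r δ` of the energy shell `E ≤ V²/2` (`4Vδ ≤ r`, `ε + 2r < 1/2`):

* `window_ae` (registered sub-goal `lambert_window_ae`) — for every datum and `γ^ℕ`-a.e. noise the
  Lambertian collision instants pass `δ` and `Λ_δ` lies in the hard-sphere domain;
* `window_measure_le_of_kick` — the annealed transport inequality
  `(vol|_{shortGood(r) ∩ shell} ⊗ γ^ℕ) {Λ_δ ∈ B} ≤ vol B`, *given* the one-pair transport inequality of
  the Lambertian pre-kick `J` (hypothesis `hkick`, the cosine law of the redraw, discharged in
  `…LambertianEulerWindow`): `Λ_δ = Φ_δ` on the no-collision pieces, `Λ_δ = Φ_δ ∘ J_{ξs 0}` a.s. on the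
  hit pieces, whose targets (interaction length `2Vδ`) together with the far set and the no-hit pieces
  are disjoint pieces of `shortGood(2Vδ) ∩ shell`, where the deterministic flow does not lose volume
  (`Alexander.volume_shortGood_inter_preimage_fwdFlow_le`).
-/

noncomputable section

open MeasureTheory ProbabilityTheory Set Function Filter Metric
open scoped ENNReal InnerProductSpace Real BigOperators

namespace Summit.AtomisticToContinuum.HydrodynamicLimit.Theorems

open Literature.MathematicalPhysics.KineticTheory Literature.Analysis.FluidPDE
  Literature.Analysis.FluidPDE.Alexander

namespace LambertianContactSwapLambertianEulerWindowPieces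

open LWindow

variable {N : ℕ} {ε r r' δ V : ℝ}

/-! ## The pre-kick is measurable; the head of the noise -/

section Kick

/-- **The Lambertian pre-kick `J_ξ z = S_{-τ₀} ∘ C_{ij} ∘ L_{ij,ξ} ∘ S_{τ₀} z` is jointly measurable**
in the datum and the noise (hitting time, free flight, redraw and reflection are measurable).
[folklore] -/
theorem measurable_lambertPreKick (ε : ℝ) (i j : Fin N) :
    Measurable fun p : Config N (Fin 3) T3 × V3 => freeFlight (Torus.geometry (Fin 3))
      (-pairHitTime ε ((Torus.geometry (Fin 3)).sepVec (p.1 i).1 (p.1 j).1) ((p.1 i).2 - (p.1 j).2))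
      (collidePair (Torus.geometry (Fin 3)) i j (lambertPair (Torus.geometry (Fin 3)) i j
        (freeFlight (Torus.geometry (Fin 3))
          (pairHitTime ε ((Torus.geometry (Fin 3)).sepVec (p.1 i).1 (p.1 j).1) ((p.1 i).2 - (p.1 j).2)) p.1)
        p.2)) := by
  have hGm : (Torus.geometry (Fin 3)).IsMeasurable := Torus.isMeasurable_geometry
  have hτ : Measurable fun p : Config N (Fin 3) T3 × V3 =>
      pairHitTime ε ((Torus.geometry (Fin 3)).sepVec (p.1 i).1 (p.1 j).1) ((p.1 i).2 - (p.1 j).2) :=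
    (measurable_pairHitTime_config ε i j).comp measurable_fst
  have h1 : Measurable fun p : Config N (Fin 3) T3 × V3 => freeFlight (Torus.geometry (Fin 3))
      (pairHitTime ε ((Torus.geometry (Fin 3)).sepVec (p.1 i).1 (p.1 j).1) ((p.1 i).2 - (p.1 j).2)) p.1 :=
    hGm.measurable_freeFlight₂.comp (hτ.prodMk measurable_fst)
  have h2 : Measurable fun p : Config N (Fin 3) T3 × V3 =>
      lambertPair (Torus.geometry (Fin 3)) i j (freeFlight (Torus.geometry (Fin 3))
        (pairHitTime ε ((Torus.geometry (Fin 3)).sepVec (p.1 i).1 (p.1 j).1) ((p.1 i).2 - (p.1 j).2)) p.1) p.2 :=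
    (measurable_lambertPair hGm i j).comp (h1.prodMk measurable_snd)
  have h3 := (hGm.measurable_collidePair i j).comp h2
  exact hGm.measurable_freeFlight₂.comp (hτ.neg.prodMk h3)

/-- For a fixed datum, the pre-kick is a measurable function of the noise. [folklore] -/
theorem measurable_lambertPreKick_right (ε : ℝ) (i j : Fin N) (z : Config N (Fin 3) T3) :
    Measurable fun ξ : V3 => freeFlight (Torus.geometry (Fin 3))
      (-pairHitTime ε ((Torus.geometry (Fin 3)).sepVec (z i).1 (z j).1) ((z i).2 - (z j).2))
      (collidePair (Torus.geometry (Fin 3)) i j (lambertPair (Torus.geometry (Fin 3)) i j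
        (freeFlight (Torus.geometry (Fin 3))
          (pairHitTime ε ((Torus.geometry (Fin 3)).sepVec (z i).1 (z j).1) ((z i).2 - (z j).2)) z) ξ)) := by
  change Measurable ((fun p : Config N (Fin 3) T3 × V3 => freeFlight (Torus.geometry (Fin 3))
      (-pairHitTime ε ((Torus.geometry (Fin 3)).sepVec (p.1 i).1 (p.1 j).1) ((p.1 i).2 - (p.1 j).2))
      (collidePair (Torus.geometry (Fin 3)) i j (lambertPair (Torus.geometry (Fin 3)) i j
        (freeFlight (Torus.geometry (Fin 3))
          (pairHitTime ε ((Torus.geometry (Fin 3)).sepVec (p.1 i).1 (p.1 j).1) ((p.1 i).2 - (p.1 j).2)) p.1)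
        p.2))) ∘ fun ξ : V3 => (z, ξ))
  exact (measurable_lambertPreKick ε i j).comp (measurable_const.prodMk measurable_id)

/-- Integrating a function of the first Gaussian vector against the Lambertian noise. [folklore] -/
theorem lintegral_lambertNoise_head {f : V3 → ℝ≥0∞} (hf : Measurable f) :
    ∫⁻ ξs, f (ξs 0) ∂(lambertNoise (Fin 3)) = ∫⁻ ξ, f ξ ∂(stdGaussian V3) :=
  (measurePreserving_eval_infinitePi (fun _ : ℕ => stdGaussian V3) 0).lintegral_comp hf

/-- The first Gaussian vector of the Lambertian noise gives a non-degenerate Lambertian direction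
about any normal, almost surely. [folklore] -/
theorem ae_lambertNoise_lambertDir_head_ne_zero (n : V3) :
    ∀ᵐ ξs ∂(lambertNoise (Fin 3)), lambertDir n (ξs 0) ≠ 0 :=
  (measurePreserving_eval_infinitePi (fun _ : ℕ => stdGaussian V3) 0).quasiMeasurePreserving.ae
    (ae_stdGaussian_lambertDir_ne_zero_euclideanSpace n)

end Kick

/-! ## Comparing pieces of two interaction lengths -/

section Pieces

/-- Shrinking the interaction length moves a no-hit datum to the no-hit piece or to the far set.
[folklore] -/
theorem noHitPiece_subset_union (hr' : r' ≤ r) (i j : Fin N) :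
    (noHitPiece N ε r δ i j : Set (Config N (Fin 3) T3)) ⊆ noHitPiece N ε r' δ i j ∪ farSet N ε r' := by
  rintro z ⟨ho, hq, hq', hnh⟩
  by_cases hle : ‖(Torus.geometry (Fin 3)).sepVec (z i).1 (z j).1‖ ≤ ε + r'
  · exact Or.inl ⟨fun k l hkl hne => lt_of_le_of_lt (by linarith) (ho k l hkl hne), hq, hle, hnh⟩
  · refine Or.inr fun k l hkl => ?_
    by_cases hne : ({k, l} : Finset (Fin N)) = {i, j}
    · rcases finsetPair_eq_iff.1 hne with ⟨rfl, rfl⟩ | ⟨rfl, rfl⟩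
      · exact not_le.1 hle
      · rw [norm_sepVec_comm]; exact not_le.1 hle
    · exact lt_of_le_of_lt (by linarith) (ho k l hkl hne)

/-- A far datum is in no hit piece of a smaller interaction length. [folklore] -/
theorem not_mem_hitPiece_of_mem_farSet_of_le (hr' : r' ≤ r) {z : Config N (Fin 3) T3}
    (hz : z ∈ farSet N ε r) {k l : Fin N} (hkl : k ≠ l) : z ∉ hitPiece N ε r' δ k l :=
  fun h => (not_le.2 (hz k l hkl)) (h.2.1.trans (by linarith))

/-- A no-hit datum is in no hit piece of a smaller interaction length (ordered pairs). [folklore] -/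
theorem not_mem_hitPiece_of_mem_noHitPiece_of_le (hr' : r' ≤ r) {z : Config N (Fin 3) T3}
    {i j : Fin N} (hij : i < j) (hz : z ∈ noHitPiece N ε r δ i j) {k l : Fin N} (hkl : k < l) :
    z ∉ hitPiece N ε r' δ k l := by
  intro h
  by_cases hp : ({k, l} : Finset (Fin N)) = {i, j}
  · obtain ⟨rfl, rfl⟩ := eq_of_pair_eq_of_lt hij hkl hp
    rcases hz.2.2.2 with hnh | hnh
    · exact hnh (PairHits.of_mem_billiardGood h.2.2.1)
    · exact (not_le.2 hnh) h.2.2.2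
  · exact (not_le.2 (hz.1 k l hkl.ne hp)) (h.2.1.trans (by linarith))

end Pieces

/-! ## Clause (ii): almost-sure regularity over the window -/

section AE

/-- **Clause (ii) of the window step**: for a short-time good datum of the energy shell
(`4Vδ ≤ r`, `ε + 2r < 1/2`), for `γ^ℕ`-a.e. noise the Lambertian collision instants pass `δ` and the
Lambertian flow at time `δ` lies in the hard-sphere domain (`LWindow.lambert_window_free` on the
no-collision pieces; on a hit piece `LWindow.lambert_window_hit` for non-degenerate first noise, which
holds almost surely, and the pre-kicked datum is short-time good with interaction length `2Vδ`,
`LWindow.hitHyp_lambertKick`). [folklore] -/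
theorem window_ae (hε : 0 < ε) (hV0 : 0 ≤ V) (hδ : 0 ≤ δ) (hr4 : 4 * V * δ ≤ r)
    (hεr : ε + 2 * r < 2⁻¹) {z : Config N (Fin 3) T3} (hz : z ∈ shortGood N ε r δ)
    (hE : configEnergy z ≤ V ^ 2 / 2) :
    ∀ᵐ ξs ∂(lambertNoise (Fin 3)),
      (∃ k, ENNReal.ofReal δ < lambertInstant (Torus.geometry (Fin 3)) ε ξs z k) ∧
      lambertFlow (Torus.geometry (Fin 3)) ε ξs z δ ∈ hardSphereDomain (Torus.geometry (Fin 3)) N ε := by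
  have hr2 : 2 * V * δ ≤ r := by nlinarith
  have hε' : ε < 2⁻¹ := by nlinarith
  have hεr' : ε + 2 * (2 * V * δ) < 2⁻¹ := by linarith
  have hV : ∀ k, ‖(z k).2‖ ≤ V := norm_vel_le_of_configEnergy_le hV0 hE
  -- the no-collision pieces
  have free : (∀ t ∈ Icc (0 : ℝ) δ, ∀ k l : Fin N, k ≠ l →
      ε < ‖(Torus.geometry (Fin 3)).sepVec (freeFlight (Torus.geometry (Fin 3)) t z k).1
        (freeFlight (Torus.geometry (Fin 3)) t z l).1‖) →
      ∀ᵐ ξs ∂(lambertNoise (Fin 3)),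
        (∃ k, ENNReal.ofReal δ < lambertInstant (Torus.geometry (Fin 3)) ε ξs z k) ∧
        lambertFlow (Torus.geometry (Fin 3)) ε ξs z δ ∈ hardSphereDomain (Torus.geometry (Fin 3)) N ε := by
    intro H
    refine ae_of_all _ fun ξs => ?_
    obtain ⟨-, -, hk, hflow, -⟩ := lambert_window_free hε' hδ H ξs
    refine ⟨hk, ?_⟩
    rw [hflow δ ⟨hδ, le_rfl⟩]
    exact fwdFlow_mem_of_mem_shortGood hε hεr hr2 hV0 hδ hE hz ⟨hδ, le_rfl⟩
  rcases mem_shortGood.1 hz with hfar | ⟨p, hp, hno | hhit⟩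
  · exact free (forall_lt_norm_of_mem_farSet hV hr2 hfar)
  · exact free (forall_lt_norm_of_mem_noHitPiece hε hV hr2 hεr hno)
  · have h : HitHyp ε r δ V z p.1 p.2 := HitHyp.mk hε hεr hr2 hV0 hE hp hhit
    filter_upwards [ae_lambertNoise_lambertDir_head_ne_zero
      (hitPoint ε ((Torus.geometry (Fin 3)).sepVec (z p.1).1 (z p.2).1, (z p.1).2 - (z p.2).2))] with ξs hξ
    obtain ⟨-, -, hk, hflow, -⟩ := lambert_window_hit h hr4 hξ
    obtain ⟨hH, -, -⟩ := hitHyp_lambertKick h hr4 hξ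
    refine ⟨hk, ?_⟩
    rw [hflow]
    exact fwdFlow_mem_of_mem_shortGood hε hεr' le_rfl hV0 hδ hH.energy
      (mem_shortGood.2 (Or.inr ⟨p, hp, Or.inr hH.mem⟩)) ⟨hδ, le_rfl⟩

/-- **Almost-sure regularity of the Lambertian flow over a short window** (clause (ii) of stub
`stub_windowLambda`, registered sub-goal `lambert_window_ae`): for every short-time good datum of the
energy shell and `γ^ℕ`-a.e. noise the collision instants pass `δ` and `Λ_δ` is in the domain. [folklore] -/
theorem lambert_window_ae :
    ∀ {ε : ℝ}, 0 < ε → ∀ {N : ℕ} {V r δ : ℝ}, 0 ≤ V → 0 ≤ δ → 4 * V * δ ≤ r → ε + 2 * r < 2⁻¹ →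
      ∀ z : Config N (Fin 3) T3, z ∈ shortGood N ε r δ → configEnergy z ≤ V ^ 2 / 2 →
        ∀ᵐ ξs ∂(lambertNoise (Fin 3)),
          (∃ k, ENNReal.ofReal δ < lambertInstant (Torus.geometry (Fin 3)) ε ξs z k) ∧
          lambertFlow (Torus.geometry (Fin 3)) ε ξs z δ ∈
            hardSphereDomain (Torus.geometry (Fin 3)) N ε :=
  fun hε _ _ _ _ hV0 hδ hr4 hεr _ hz hE => window_ae hε hV0 hδ hr4 hεr hz hE

end AE

/-! ## Clause (i): the annealed transport inequality, given the pre-kick transport -/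

section Transport

/-- **Clause (i) of the window step, given the one-pair transport inequality of the pre-kick.**
Assume `hkick`: for every ordered pair `i < j` and measurable `F ≥ 0`,
`∫_{hitPiece(r) i j ∩ shell} ∫ F (J_ξ z) dγ(ξ) dz ≤ ∫_{hitPiece(2Vδ) i j ∩ shell} F` (the cosine law of
the redraw). Then for every measurable `B`,
`(vol|_{shortGood(r) ∩ shell} ⊗ γ^ℕ) {Λ_δ ∈ B} ≤ vol B` (`4Vδ ≤ r`, `ε + 2r < 1/2`): on the
no-collision pieces `Λ_δ = Φ_δ` for every noise (`LWindow.lambert_window_free`); on the hit piece of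
`(i, j)`, `Λ_δ = Φ_δ (J_{ξs 0} z)` almost surely (`LWindow.lambert_window_hit`), so that its
contribution is at most `vol (hitPiece(2Vδ) i j ∩ shell ∩ Φ_δ⁻¹ B)`; the far set, the no-hit pieces
and the hit pieces of interaction length `2Vδ` are pairwise disjoint pieces of
`shortGood(2Vδ) ∩ shell`, where the deterministic flow does not lose volume
(`Alexander.volume_shortGood_inter_preimage_fwdFlow_le`). [folklore] -/
theorem window_measure_le_of_kick (hε : 0 < ε) (hV0 : 0 ≤ V) (hδ : 0 ≤ δ) (hr4 : 4 * V * δ ≤ r)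
    (hεr : ε + 2 * r < 2⁻¹)
    (hkick : ∀ i j : Fin N, i < j → ∀ F : Config N (Fin 3) T3 → ℝ≥0∞, Measurable F →
      ∫⁻ z in hitPiece N ε r δ i j ∩ {z | configEnergy z ≤ V ^ 2 / 2},
          ∫⁻ ξ, F (freeFlight (Torus.geometry (Fin 3))
            (-pairHitTime ε ((Torus.geometry (Fin 3)).sepVec (z i).1 (z j).1) ((z i).2 - (z j).2))
            (collidePair (Torus.geometry (Fin 3)) i j (lambertPair (Torus.geometry (Fin 3)) i j
              (freeFlight (Torus.geometry (Fin 3))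
                (pairHitTime ε ((Torus.geometry (Fin 3)).sepVec (z i).1 (z j).1) ((z i).2 - (z j).2)) z) ξ)))
            ∂(stdGaussian V3) ≤
        ∫⁻ z in hitPiece N ε (2 * V * δ) δ i j ∩ {z | configEnergy z ≤ V ^ 2 / 2}, F z)
    {B : Set (Config N (Fin 3) T3)} (hB : MeasurableSet B) :
    ((volume.restrict {z : Config N (Fin 3) T3 |
        z ∈ shortGood N ε r δ ∧ configEnergy z ≤ V ^ 2 / 2}).prod (lambertNoise (Fin 3)))
      {p | lambertFlow (Torus.geometry (Fin 3)) ε p.2 p.1 δ ∈ B} ≤ volume B := by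
  have hVδ : 0 ≤ 2 * V * δ := by positivity
  have hr2 : 2 * V * δ ≤ r := by linarith
  have hr0 : 0 ≤ r := hVδ.trans hr2
  have hε' : ε < 2⁻¹ := by linarith
  have hεr' : ε + 2 * (2 * V * δ) < 2⁻¹ := by linarith
  have hG := Torus.isHardSphereRegular_geometry (d := Fin 3) hε'
  -- the deterministic flow at time `δ`
  set T : Config N (Fin 3) T3 → Config N (Fin 3) T3 :=
    fun z => fwdFlow (Torus.geometry (Fin 3)) ε z δ with hT
  have hTm : Measurable T := measurable_fwdFlow hG Torus.isMeasurable_geometry δ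
  -- the pre-kick of a pair, as a function of the noise and the datum
  set J : Fin N → Fin N → V3 → Config N (Fin 3) T3 → Config N (Fin 3) T3 := fun i j ξ z =>
    freeFlight (Torus.geometry (Fin 3))
      (-pairHitTime ε ((Torus.geometry (Fin 3)).sepVec (z i).1 (z j).1) ((z i).2 - (z j).2))
      (collidePair (Torus.geometry (Fin 3)) i j (lambertPair (Torus.geometry (Fin 3)) i j
        (freeFlight (Torus.geometry (Fin 3))
          (pairHitTime ε ((Torus.geometry (Fin 3)).sepVec (z i).1 (z j).1) ((z i).2 - (z j).2)) z) ξ))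
    with hJ
  -- the shell, the source set and the event
  set shell : Set (Config N (Fin 3) T3) := {z | configEnergy z ≤ V ^ 2 / 2} with hshell
  have hshellm : MeasurableSet shell := measurableSet_energyShell _
  set S : Set (Config N (Fin 3) T3) :=
    {z | z ∈ shortGood N ε r δ ∧ configEnergy z ≤ V ^ 2 / 2} with hS
  have hSm : MeasurableSet S := (measurableSet_shortGood ε r δ).inter hshellm
  set A : Set (Config N (Fin 3) T3 × (ℕ → V3)) :=
    {p | lambertFlow (Torus.geometry (Fin 3)) ε p.2 p.1 δ ∈ B} with hA
  have hAm : MeasurableSet A := measurable_lambertFlow_torus hε' δ hB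
  rw [Measure.prod_apply hAm]
  -- the section measure
  set g : Config N (Fin 3) T3 → ℝ≥0∞ := fun z => lambertNoise (Fin 3) (Prod.mk z ⁻¹' A) with hg
  have hg1 : ∀ z, g z = ∫⁻ ξs, (Prod.mk z ⁻¹' A).indicator 1 ξs ∂(lambertNoise (Fin 3)) :=
    fun z => (lintegral_indicator_one (measurable_prodMk_left hAm)).symm
  have hind : ∀ {s : Set (ℕ → V3)} {t : Set (Config N (Fin 3) T3)} {a : ℕ → V3} {b : Config N (Fin 3) T3},
      (a ∈ s ↔ b ∈ t) → s.indicator (1 : (ℕ → V3) → ℝ≥0∞) a = t.indicator 1 b := by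
    intro s t a b h
    by_cases hb : b ∈ t
    · rw [indicator_of_mem hb, indicator_of_mem (h.2 hb), Pi.one_apply, Pi.one_apply]
    · rw [indicator_of_notMem hb, indicator_of_notMem fun ha => hb (h.1 ha)]
  -- the source pieces and the target pieces, indexed by ordered pairs
  set src : Option ({p : Fin N × Fin N // p.1 < p.2} × Bool) → Set (Config N (Fin 3) T3) :=
    fun ι => ι.elim (farSet N ε r) fun q => cond q.2 (hitPiece N ε r δ q.1.1.1 q.1.1.2)
      (noHitPiece N ε r δ q.1.1.1 q.1.1.2) with hsrc
  set Q : Option ({p : Fin N × Fin N // p.1 < p.2} × Bool) → Set (Config N (Fin 3) T3) :=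
    fun ι => (ι.elim (farSet N ε r) fun q => cond q.2 (hitPiece N ε (2 * V * δ) δ q.1.1.1 q.1.1.2)
      (noHitPiece N ε r δ q.1.1.1 q.1.1.2)) ∩ shell with hQ
  have hsrcm : ∀ ι, MeasurableSet (src ι) := by
    rintro (_ | ⟨q, _ | _⟩)
    · exact measurableSet_farSet ε r
    · exact measurableSet_noHitPiece ε r δ q.1.1 q.1.2
    · exact measurableSet_hitPiece ε r δ q.1.1 q.1.2
  have hQm : ∀ ι, MeasurableSet (Q ι ∩ T ⁻¹' B) := by
    rintro (_ | ⟨q, _ | _⟩)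
    · exact ((measurableSet_farSet ε r).inter hshellm).inter (hTm hB)
    · exact ((measurableSet_noHitPiece ε r δ q.1.1 q.1.2).inter hshellm).inter (hTm hB)
    · exact ((measurableSet_hitPiece ε (2 * V * δ) δ q.1.1 q.1.2).inter hshellm).inter (hTm hB)
  -- the no-collision pieces: `Λ_δ = Φ_δ` for every noise
  have free_case : ∀ ι, (∀ z ∈ S ∩ src ι, ∀ t ∈ Icc (0 : ℝ) δ, ∀ k l : Fin N, k ≠ l →
      ε < ‖(Torus.geometry (Fin 3)).sepVec (freeFlight (Torus.geometry (Fin 3)) t z k).1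
        (freeFlight (Torus.geometry (Fin 3)) t z l).1‖) →
      S ∩ src ι ⊆ Q ι → ∫⁻ z in S ∩ src ι, g z ≤ volume (Q ι ∩ T ⁻¹' B) := by
    intro ι H hsubQ
    have hcongr : ∀ z ∈ S ∩ src ι, g z = (T ⁻¹' B).indicator 1 z := by
      intro z hz
      have hflow : ∀ ξs, lambertFlow (Torus.geometry (Fin 3)) ε ξs z δ = T z := fun ξs =>
        (lambert_window_free hε' hδ (H z hz) ξs).2.2.2.1 δ ⟨hδ, le_rfl⟩
      rw [hg1]
      calc ∫⁻ ξs, (Prod.mk z ⁻¹' A).indicator 1 ξs ∂(lambertNoise (Fin 3))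
          = ∫⁻ _ξs, (T ⁻¹' B).indicator 1 z ∂(lambertNoise (Fin 3)) := by
            refine lintegral_congr fun ξs => hind ?_
            show lambertFlow (Torus.geometry (Fin 3)) ε ξs z δ ∈ B ↔ T z ∈ B
            rw [hflow ξs]
        _ = (T ⁻¹' B).indicator 1 z := by rw [lintegral_const, measure_univ, mul_one]
    rw [setLIntegral_congr_fun (hSm.inter (hsrcm ι)) hcongr, lintegral_indicator_one (hTm hB),
      Measure.restrict_apply (hTm hB)]
    exact measure_mono fun z hz => ⟨hsubQ hz.2, hz.1⟩
  -- the per-piece bound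
  have piece : ∀ ι, ∫⁻ z in S ∩ src ι, g z ≤ volume (Q ι ∩ T ⁻¹' B) := by
    rintro (_ | ⟨q, _ | _⟩)
    · exact free_case none
        (fun z hz => forall_lt_norm_of_mem_farSet (norm_vel_le_of_configEnergy_le hV0 hz.1.2) hr2 hz.2)
        (fun z hz => ⟨hz.2, hz.1.2⟩)
    · exact free_case _
        (fun z hz => forall_lt_norm_of_mem_noHitPiece hε (norm_vel_le_of_configEnergy_le hV0 hz.1.2) hr2
          hεr hz.2)
        (fun z hz => ⟨hz.2, hz.1.2⟩)
    · -- the hit piece of `q`: the pre-kick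
      have hq : q.1.1 < q.1.2 := q.2
      have hsub : S ∩ src (some (q, true)) ⊆ hitPiece N ε r δ q.1.1 q.1.2 ∩ shell :=
        fun z hz => ⟨hz.2, hz.1.2⟩
      have hFm : Measurable ((T ⁻¹' B).indicator (1 : Config N (Fin 3) T3 → ℝ≥0∞)) :=
        measurable_one.indicator (hTm hB)
      have hcongr : ∀ z ∈ S ∩ src (some (q, true)),
          g z = ∫⁻ ξ, (T ⁻¹' B).indicator 1 (J q.1.1 q.1.2 ξ z) ∂(stdGaussian V3) := by
        intro z hz
        obtain ⟨hzmem, hzE⟩ := hsub hz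
        have h : HitHyp ε r δ V z q.1.1 q.1.2 := HitHyp.mk hε hεr hr2 hV0 hzE hq hzmem
        rw [hg1]
        calc ∫⁻ ξs, (Prod.mk z ⁻¹' A).indicator 1 ξs ∂(lambertNoise (Fin 3))
            = ∫⁻ ξs, (T ⁻¹' B).indicator 1 (J q.1.1 q.1.2 (ξs 0) z) ∂(lambertNoise (Fin 3)) := by
              refine lintegral_congr_ae ?_
              filter_upwards [ae_lambertNoise_lambertDir_head_ne_zero (hitPoint ε
                ((Torus.geometry (Fin 3)).sepVec (z q.1.1).1 (z q.1.2).1,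
                  (z q.1.1).2 - (z q.1.2).2))] with ξs hξ
              have hflow := (lambert_window_hit h hr4 hξ).2.2.2.1
              refine hind ?_
              show lambertFlow (Torus.geometry (Fin 3)) ε ξs z δ ∈ B ↔ _ ∈ T ⁻¹' B
              rw [hflow]
              exact Iff.rfl
          _ = _ := lintegral_lambertNoise_head (hFm.comp (measurable_lambertPreKick_right ε q.1.1 q.1.2 z))
      calc ∫⁻ z in S ∩ src (some (q, true)), g z
          = ∫⁻ z in S ∩ src (some (q, true)), _ := setLIntegral_congr_fun (hSm.inter (hsrcm _)) hcongr
        _ ≤ ∫⁻ z in hitPiece N ε r δ q.1.1 q.1.2 ∩ shell, _ := lintegral_mono_set hsub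
        _ ≤ ∫⁻ z in hitPiece N ε (2 * V * δ) δ q.1.1 q.1.2 ∩ shell, (T ⁻¹' B).indicator 1 z :=
          hkick q.1.1 q.1.2 hq _ hFm
        _ = volume (Q (some (q, true)) ∩ T ⁻¹' B) := by
          rw [lintegral_indicator_one (hTm hB), Measure.restrict_apply (hTm hB), inter_comm]
          rfl
  -- the targets are disjoint
  have hdisj : Pairwise (Disjoint on fun ι => Q ι ∩ T ⁻¹' B) := by
    intro ι ι' hne
    rw [Function.onFun, disjoint_left]
    rintro z ⟨⟨hz, -⟩, -⟩ ⟨⟨hz', -⟩, -⟩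
    apply hne
    rcases ι with _ | ⟨q, _ | _⟩ <;> rcases ι' with _ | ⟨q', _ | _⟩
    · rfl
    · have hn' : z ∈ noHitPiece N ε r δ q'.1.1 q'.1.2 := hz'
      exact absurd hn'.2.2.1 (not_le.2 (hz _ _ q'.2.ne))
    · exact absurd hz' (not_mem_hitPiece_of_mem_farSet_of_le hr2 hz q'.2.ne)
    · have hn : z ∈ noHitPiece N ε r δ q.1.1 q.1.2 := hz
      exact absurd hn.2.2.1 (not_le.2 (hz' _ _ q.2.ne))
    · have hn : z ∈ noHitPiece N ε r δ q.1.1 q.1.2 := hz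
      have hn' : z ∈ noHitPiece N ε r δ q'.1.1 q'.1.2 := hz'
      by_cases hqq : ({q'.1.1, q'.1.2} : Finset (Fin N)) = {q.1.1, q.1.2}
      · obtain ⟨h1, h2⟩ := eq_of_pair_eq_of_lt q.2 q'.2 hqq
        rw [show q' = q from Subtype.ext (Prod.ext h1 h2)]
      · exact absurd hn'.2.2.1 (not_le.2 (hn.1 _ _ q'.2.ne hqq))
    · exact absurd hz' (not_mem_hitPiece_of_mem_noHitPiece_of_le hr2 q.2 hz q'.2)
    · exact absurd hz (not_mem_hitPiece_of_mem_farSet_of_le hr2 hz' q.2.ne)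
    · exact absurd hz (not_mem_hitPiece_of_mem_noHitPiece_of_le hr2 q'.2 hz' q.2)
    · obtain ⟨h1, h2⟩ := eq_of_mem_hitPiece_of_mem_hitPiece q.2 q'.2 hz hz'
      rw [show q' = q from Subtype.ext (Prod.ext h1 h2)]
  -- the targets are short-time good with interaction length `2Vδ`
  have hQsub : ∀ ι, Q ι ⊆ {z : Config N (Fin 3) T3 | z ∈ shortGood N ε (2 * V * δ) δ ∧
      configEnergy z ≤ V ^ 2 / 2} := by
    rintro (_ | ⟨q, _ | _⟩) z ⟨hz, hE⟩
    · exact ⟨mem_shortGood.2 (Or.inl fun k l hkl => lt_of_le_of_lt (by linarith) (hz k l hkl)), hE⟩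
    · refine ⟨?_, hE⟩
      rcases noHitPiece_subset_union hr2 q.1.1 q.1.2 hz with h | h
      · exact mem_shortGood.2 (Or.inr ⟨q.1, q.2, Or.inl h⟩)
      · exact mem_shortGood.2 (Or.inl h)
    · exact ⟨mem_shortGood.2 (Or.inr ⟨q.1, q.2, Or.inr hz⟩), hE⟩
  -- assemble
  calc ∫⁻ z in S, g z ≤ ∫⁻ z in ⋃ ι, S ∩ src ι, g z := by
        refine lintegral_mono_set fun z hz => ?_
        rcases mem_shortGood.1 hz.1 with hfar | ⟨p, hp, hno | hhit⟩
        · exact mem_iUnion.2 ⟨none, hz, hfar⟩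
        · exact mem_iUnion.2 ⟨some (⟨p, hp⟩, false), hz, hno⟩
        · exact mem_iUnion.2 ⟨some (⟨p, hp⟩, true), hz, hhit⟩
    _ ≤ ∑' ι, ∫⁻ z in S ∩ src ι, g z := lintegral_iUnion_le _ _
    _ = ∑ ι, ∫⁻ z in S ∩ src ι, g z := tsum_fintype _
    _ ≤ ∑ ι, volume (Q ι ∩ T ⁻¹' B) := Finset.sum_le_sum fun ι _ => piece ι
    _ = volume (⋃ ι, Q ι ∩ T ⁻¹' B) := by rw [measure_iUnion hdisj hQm, tsum_fintype]
    _ ≤ volume {z : Config N (Fin 3) T3 | z ∈ shortGood N ε (2 * V * δ) δ ∧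
          configEnergy z ≤ V ^ 2 / 2 ∧ fwdFlow (Torus.geometry (Fin 3)) ε z δ ∈ B} := by
        refine measure_mono (iUnion_subset fun ι => ?_)
        rintro z ⟨hz, hzB⟩
        exact ⟨(hQsub ι hz).1, (hQsub ι hz).2, hzB⟩
    _ ≤ volume B := volume_shortGood_inter_preimage_fwdFlow_le hε hεr' le_rfl hV0 hδ hB

end Transport

end LambertianContactSwapLambertianEulerWindowPieces

end Summit.AtomisticToContinuum.HydrodynamicLimit.Theorems
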